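import Summits.ValiantsHypothesis.ValiantsHypothesis.Theorems.ZeroOneTransfer.Negative.KillRows

/-!
# `ZeroOneTransfer` — negative lemma: arborescences are exchange-connected; supports of positive
# projections of `ST_N` move by one label (crux `stmt-ValiantsHypothesis-5066`, Disproof §(G))

`exists_exchange` (for arborescences `t ≠ t'` some differing node can be re-hung onto its
`t'`-parent), `arborescence_chain_induction`; `aeval_stPoly_label` / `coeff_aeval_stPoly_label` /
`vexp_update` (a positive projection `ST_N(e)`, `e v ∈ {X j} ∪ {C r}`, is `Σ_t cst_t · x^{vexp t}` over
arborescences, and one exchange moves `vexp` by ONE label); hence `not_posProj_stPoly_of_split`,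
`not_posProj_stPoly_of_isolated`: a polynomial whose monomials split into two classes with no
one-label bridge is NOT a positive projection of any `ST_N` — a necessary condition for the normal
forms of crux card `arborescence-span`.  Instances: `ExchangeFace.lean`, `ExchangePerDimer.lean`,
`ExchangeSum.lean`. [folklore] [cite: JerrumSnir1982, §4.5]
-/

namespace Summit.ValiantsHypothesis.ValiantsHypothesis.Theorems.ZeroOneTransfer.Negative

set_option linter.dupNamespace false

open Literature.Computability.AlgebraicComplexity Literature.Barriers.ValiantsHypothesis
open MvPolynomial Finset
open scoped NNReal

noncomputable section

variable {N : ℕ}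

/-- `a` is a `t`-descendant of `i`: iterating the parent map from `a` reaches `i` (`a = i`
included). [folklore] -/
def IsDesc (t : Fin N → Option (Fin N)) (i a : Fin N) : Prop :=
  ∃ k, (parentMap t)^[k] (some a) = some i

/-- Every node is its own descendant. [folklore] -/
theorem isDesc_refl (t : Fin N → Option (Fin N)) (i : Fin N) : IsDesc t i i := ⟨0, rfl⟩

/-- The root stays the root under iteration. [folklore] -/
theorem iterate_parentMap_none (t : Fin N → Option (Fin N)) (k : ℕ) :
    (parentMap t)^[k] none = none :=
  Function.iterate_fixed (parentMap_none t) k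

/-- A child of a descendant is a descendant. [folklore] -/
theorem isDesc_of_parent {t : Fin N → Option (Fin N)} {i a b : Fin N} (hab : t a = some b)
    (hb : IsDesc t i b) : IsDesc t i a := by
  obtain ⟨k, hk⟩ := hb
  exact ⟨k + 1, by rw [Function.iterate_succ_apply, parentMap_some, hab, hk]⟩

/-- The parent of a proper descendant is a descendant. [folklore] -/
theorem isDesc_parent {t : Fin N → Option (Fin N)} {i a : Fin N} (ha : IsDesc t i a) (hne : a ≠ i) :
    ∃ b, t a = some b ∧ IsDesc t i b := by
  obtain ⟨k, hk⟩ := ha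
  cases k with
  | zero => exact absurd (Option.some_injective _ hk) hne
  | succ k =>
    rw [Function.iterate_succ_apply, parentMap_some] at hk
    cases hta : t a with
    | none => rw [hta, iterate_parentMap_none] at hk; exact absurd hk (by simp)
    | some b => exact ⟨b, rfl, k, by rw [← hta]; exact hk⟩

/-- Ranks drop by at least the number of steps along parent chains. [folklore] -/
theorem rank_add_le_of_iterate {t : Fin N → Option (Fin N)} {rk : Fin N → ℕ}
    (hrk : ∀ i j, t i = some j → rk j < rk i) :
    ∀ (k : ℕ) (a b : Fin N), (parentMap t)^[k] (some a) = some b → rk b + k ≤ rk a := by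
  intro k
  induction k with
  | zero => intro a b h; have := Option.some_injective _ h; subst this; simp
  | succ k ih =>
    intro a b h
    rw [Function.iterate_succ_apply, parentMap_some] at h
    cases hta : t a with
    | none => rw [hta, iterate_parentMap_none] at h; exact absurd h (by simp)
    | some a' => rw [hta] at h; have h1 := ih a' b h; have h2 := hrk a a' hta; omega

/-- Intermediate points of a parent chain ending at a node are nodes. [folklore] -/
theorem exists_iterate_eq_some {t : Fin N → Option (Fin N)} {k : ℕ} {a i : Fin N}
    (hk : (parentMap t)^[k] (some a) = some i) {m : ℕ} (hm : m ≤ k) :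
    ∃ b, (parentMap t)^[m] (some a) = some b ∧ (parentMap t)^[k - m] (some b) = some i := by
  cases h : (parentMap t)^[m] (some a) with
  | none =>
    have : (parentMap t)^[k - m + m] (some a) = none := by
      rw [Function.iterate_add_apply, h, iterate_parentMap_none]
    rw [Nat.sub_add_cancel hm, hk] at this
    exact absurd this (by simp)
  | some b =>
    refine ⟨b, rfl, ?_⟩
    have : (parentMap t)^[k - m + m] (some a) = some i := by rw [Nat.sub_add_cancel hm, hk]
    rwa [Function.iterate_add_apply, h] at this

/-- **Single exchange.**  For distinct arborescences `t ≠ t'` some differing node `i` can be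
re-hung onto its `t'`-parent: `update t i (t' i)` is an arborescence.  Proof: take a differing
node `i` of maximal `t`-rank.  If its `t'`-parent `w` were a `t`-descendant of `i`, all nodes on
the `t`-path from `w` up to `i` would have larger rank, hence agree in `t` and `t'`, and `t'`
would contain the cycle `i → w → ⋯ → i`.  So `w` is not below `i`, and shifting the ranks of the
subtree of `i` above everything ranks the new map. [folklore] -/
theorem exists_exchange {t t' : Fin N → Option (Fin N)} (ht : IsArborescence t)
    (ht' : IsArborescence t') (hne : t ≠ t') :
    ∃ i, t i ≠ t' i ∧ IsArborescence (Function.update t i (t' i)) := by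
  classical
  obtain ⟨rk, hrk⟩ := (isArborescence_iff_exists_rank t).1 ht
  obtain ⟨rk', hrk'⟩ := (isArborescence_iff_exists_rank t').1 ht'
  set D := Finset.univ.filter (fun i => t i ≠ t' i) with hD
  have hDne : D.Nonempty := by
    by_contra h
    rw [Finset.not_nonempty_iff_eq_empty] at h
    apply hne
    funext i
    by_contra hi
    have : i ∈ D := by simp [hD, hi]
    rw [h] at this
    simp at this
  obtain ⟨i, hiD, himax⟩ := Finset.exists_max_image D rk hDne
  have hi : t i ≠ t' i := (Finset.mem_filter.1 hiD).2
  refine ⟨i, hi, ?_⟩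
  -- key: the `t'`-parent of `i` is not a `t`-descendant of `i`
  have hkey : ∀ w, t' i = some w → ¬ IsDesc t i w := by
    rintro w hw ⟨k, hk⟩
    have hpath : ∀ m, m ≤ k → (parentMap t')^[m] (some w) = (parentMap t)^[m] (some w) := by
      intro m
      induction m with
      | zero => intro; rfl
      | succ m ih =>
        intro hm
        obtain ⟨b, hb, hbi⟩ := exists_iterate_eq_some hk (show m ≤ k by omega)
        rw [Function.iterate_succ_apply', Function.iterate_succ_apply', ih (by omega), hb,
          parentMap_some, parentMap_some]
        -- `b` is a proper descendant of `i`: its rank is larger, so it is not a differing node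
        have h1 := rank_add_le_of_iterate hrk (k - m) b i hbi
        have hbD : b ∉ D := fun hbD => by have := himax b hbD; omega
        have hbb : t b = t' b := by
          by_contra h
          exact hbD (by simp [hD, h])
        rw [hbb]
    have hk' : (parentMap t')^[k] (some w) = some i := by rw [hpath k le_rfl, hk]
    have h1 := rank_add_le_of_iterate hrk' k w i hk'
    have h2 := hrk' i w hw; omega
  rw [isArborescence_iff_exists_rank]
  cases hti : t' i with
  | none =>
    refine ⟨rk, fun a b hab => ?_⟩
    by_cases hai : a = i
    · subst hai; rw [Function.update_self] at hab; cases hab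
    · rw [Function.update_of_ne hai] at hab; exact hrk a b hab
  | some w =>
    have hw : ¬ IsDesc t i w := hkey w hti
    refine ⟨fun a => if IsDesc t i a then rk a + (rk w + 1) else rk a, fun a b hab => ?_⟩
    by_cases hai : a = i
    · subst hai
      rw [Function.update_self] at hab
      cases hab
      simp only [if_pos (isDesc_refl t a), if_neg hw]
      omega
    · rw [Function.update_of_ne hai] at hab
      by_cases ha : IsDesc t i a
      · -- `b`, the `t`-parent of the proper descendant `a`, is a descendant too
        obtain ⟨b', hb', hb'd⟩ := isDesc_parent ha hai
        rw [hab] at hb'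
        cases hb'
        simp only [if_pos ha, if_pos hb'd]
        have := hrk a b hab
        omega
      · have hb : ¬ IsDesc t i b := fun hb => ha (isDesc_of_parent hab hb)
        simp only [if_neg ha, if_neg hb]; exact hrk a b hab

/-- **Exchange connectivity (induction principle).**  A property of parent maps that holds at
the arborescence `t` and is preserved by single exchanges towards `t'` (among arborescences whose
every pointer is a `t`- or a `t'`-pointer) holds at the arborescence `t'`. [folklore] -/
theorem arborescence_chain_induction {t t' : Fin N → Option (Fin N)} (ht : IsArborescence t)
    (ht' : IsArborescence t') (P : (Fin N → Option (Fin N)) → Prop) (h0 : P t)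
    (hstep : ∀ (s : Fin N → Option (Fin N)) (i : Fin N), IsArborescence s →
      (∀ j, s j = t j ∨ s j = t' j) → P s → IsArborescence (Function.update s i (t' i)) →
      P (Function.update s i (t' i))) :
    P t' := by
  classical
  -- induction on the number of nodes where `s` differs from `t'`
  suffices H : ∀ (n : ℕ) (s : Fin N → Option (Fin N)), IsArborescence s →
      (∀ j, s j = t j ∨ s j = t' j) → P s →
      (Finset.univ.filter fun j => s j ≠ t' j).card ≤ n → P t' by
    exact H _ t ht (fun j => Or.inl rfl) h0 le_rfl
  intro n
  induction n with
  | zero =>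
    intro s _ _ hP hcard
    have hst : s = t' := by
      funext j
      by_contra hj
      have : j ∈ Finset.univ.filter (fun j => s j ≠ t' j) := by simp [hj]
      rw [Finset.card_eq_zero.mp (Nat.le_zero.mp hcard)] at this
      simp at this
    rwa [hst] at hP
  | succ n ih =>
    intro s hs hst hP hcard
    by_cases heq : s = t'
    · rwa [heq] at hP
    obtain ⟨i, hi, hs'⟩ := exists_exchange hs ht' heq
    refine ih (Function.update s i (t' i)) hs' ?_ (hstep s i hs hst hP hs') ?_
    · intro j
      by_cases hji : j = i
      · subst hji; right; exact Function.update_self _ _ _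
      · rw [Function.update_of_ne hji]; exact hst j
    · -- the differing set strictly shrinks
      have hsub : (Finset.univ.filter fun j => Function.update s i (t' i) j ≠ t' j) ⊂
          Finset.univ.filter fun j => s j ≠ t' j := by
        rw [Finset.ssubset_iff_of_subset]
        · refine ⟨i, by simp [hi], ?_⟩
          simp
        · intro j hj
          simp only [Finset.mem_filter, Finset.mem_univ, true_and] at hj ⊢
          by_cases hji : j = i
          · subst hji; simp at hj
          · rwa [Function.update_of_ne hji] at hj
      have := Finset.card_lt_card hsub
      omega


section PosSubst

variable {τ : Type*}

/-- The exponent carried by a label (a variable `j ↦ e_j`, a constant `↦ 0`). [folklore] -/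
def lexp (l : τ ⊕ ℝ≥0) : τ →₀ ℕ := Sum.elim (fun j => Finsupp.single j 1) (fun _ => 0) l

/-- The scalar carried by a label (a variable `↦ 1`, a constant `r ↦ r`). [folklore] -/
def lcst (l : τ ⊕ ℝ≥0) : ℝ≥0 := Sum.elim (fun _ => 1) id l

/-- A label is a variable or a constant: `X j = C 1 · x^{e_j}`, `C r = C r · x^0`. [folklore] -/
theorem labelPoly_eq (l : τ ⊕ ℝ≥0) :
    (Sum.elim X C l : MvPolynomial τ ℝ≥0) = monomial (lexp l) (lcst l) := by
  cases l with
  | inl j => simp only [Sum.elim_inl, lexp, lcst]; rfl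
  | inr r => simp only [Sum.elim_inr, lexp, lcst, id]; rfl

/-- The possible exponents of a label. [folklore] -/
theorem lexp_cases (l : τ ⊕ ℝ≥0) : lexp l = 0 ∨ ∃ j, lexp l = Finsupp.single j 1 := by
  cases l with
  | inl j => exact Or.inr ⟨j, rfl⟩
  | inr r => exact Or.inl rfl

/-- The exponent vector of the term of the parent map `t` under the labelling `ℓ`. [folklore] -/
def vexp (ℓ : Fin N × Option (Fin N) → τ ⊕ ℝ≥0) (t : Fin N → Option (Fin N)) : τ →₀ ℕ :=
  ∑ i : Fin N, lexp (ℓ (i, t i))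

/-- The scalar of the term of the parent map `t` under the labelling `ℓ`. [folklore] -/
def cst (ℓ : Fin N × Option (Fin N) → τ ⊕ ℝ≥0) (t : Fin N → Option (Fin N)) : ℝ≥0 :=
  ∏ i : Fin N, lcst (ℓ (i, t i))

/-- The term of `t` under a positive substitution is the monomial `cst · x^{vexp}`. [folklore] -/
theorem prod_label_eq (ℓ : Fin N × Option (Fin N) → τ ⊕ ℝ≥0) (t : Fin N → Option (Fin N)) :
    ∏ i : Fin N, (Sum.elim X C (ℓ (i, t i)) : MvPolynomial τ ℝ≥0) =
      monomial (vexp ℓ t) (cst ℓ t) := by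
  classical
  simp_rw [labelPoly_eq]
  rw [vexp, cst]
  induction (Finset.univ : Finset (Fin N)) using Finset.induction_on with
  | empty => simp
  | insert a s has ih => rw [Finset.prod_insert has, Finset.sum_insert has, Finset.prod_insert has,
      ih, monomial_mul]

/-- **A positive projection of `ST_N` as a sum of monomials over arborescences.** [folklore] -/
theorem aeval_stPoly_label (ℓ : Fin N × Option (Fin N) → τ ⊕ ℝ≥0) :
    aeval (fun v => (Sum.elim X C (ℓ v) : MvPolynomial τ ℝ≥0)) (stPoly ℝ≥0 N) =
      ∑ t ∈ arborescences N, monomial (vexp ℓ t) (cst ℓ t) := by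
  classical
  rw [stPoly_eq_sum_monomial, map_sum]
  refine Finset.sum_congr rfl fun t _ => ?_
  rw [← prod_X_arb_eq_monomial, map_prod]
  simp only [aeval_X]
  exact prod_label_eq ℓ t

/-- Coefficients of a positive projection of `ST_N`. [folklore] -/
theorem coeff_aeval_stPoly_label [DecidableEq τ] (ℓ : Fin N × Option (Fin N) → τ ⊕ ℝ≥0)
    (γ : τ →₀ ℕ) :
    coeff γ (aeval (fun v => (Sum.elim X C (ℓ v) : MvPolynomial τ ℝ≥0)) (stPoly ℝ≥0 N)) =
      ∑ t ∈ arborescences N, if vexp ℓ t = γ then cst ℓ t else 0 := by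
  classical
  rw [aeval_stPoly_label, coeff_sum]
  simp only [coeff_monomial]

/-- A surviving arborescence puts its exponent into the support (no cancellation over `ℝ≥0`).
[folklore] -/
theorem cst_le_coeff_aeval_stPoly (ℓ : Fin N × Option (Fin N) → τ ⊕ ℝ≥0)
    {t : Fin N → Option (Fin N)} (ht : IsArborescence t) :
    cst ℓ t ≤ coeff (vexp ℓ t) (aeval (fun v => (Sum.elim X C (ℓ v) : MvPolynomial τ ℝ≥0))
      (stPoly ℝ≥0 N)) := by
  classical
  rw [coeff_aeval_stPoly_label]
  have := Finset.single_le_sum (f := fun s => if vexp ℓ s = vexp ℓ t then cst ℓ s else 0)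
    (fun _ _ => zero_le) (mem_arborescences.mpr ht)
  simpa using this

/-- Conversely every monomial of a positive projection of `ST_N` comes from a surviving
arborescence. [folklore] -/
theorem exists_arborescence_of_coeff_ne_zero (ℓ : Fin N × Option (Fin N) → τ ⊕ ℝ≥0)
    {γ : τ →₀ ℕ}
    (h : coeff γ (aeval (fun v => (Sum.elim X C (ℓ v) : MvPolynomial τ ℝ≥0)) (stPoly ℝ≥0 N)) ≠ 0) :
    ∃ t, IsArborescence t ∧ vexp ℓ t = γ ∧ cst ℓ t ≠ 0 := by
  classical
  rw [coeff_aeval_stPoly_label] at h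
  obtain ⟨t, ht, hne⟩ := Finset.exists_ne_zero_of_sum_ne_zero h
  refine ⟨t, mem_arborescences.mp ht, ?_⟩
  split_ifs at hne with hv
  · exact ⟨hv, hne⟩
  · exact absurd rfl hne

/-- **One exchange moves the exponent by one label**:
`vexp (update s i x) + lexp (ℓ (i, s i)) = vexp s + lexp (ℓ (i, x))`. [folklore] -/
theorem vexp_update (ℓ : Fin N × Option (Fin N) → τ ⊕ ℝ≥0) (s : Fin N → Option (Fin N))
    (i : Fin N) (x : Option (Fin N)) :
    vexp ℓ (Function.update s i x) + lexp (ℓ (i, s i)) = vexp ℓ s + lexp (ℓ (i, x)) := by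
  classical
  unfold vexp
  have h1 : ∑ j, lexp (ℓ (j, Function.update s i x j)) =
      lexp (ℓ (i, x)) + ∑ j ∈ Finset.univ.erase i, lexp (ℓ (j, s j)) := by
    rw [← Finset.add_sum_erase _ _ (Finset.mem_univ i), Function.update_self]
    congr 1
    exact Finset.sum_congr rfl fun j hj => by rw [Function.update_of_ne (Finset.ne_of_mem_erase hj)]
  have h2 : ∑ j, lexp (ℓ (j, s j)) = lexp (ℓ (i, s i)) + ∑ j ∈ Finset.univ.erase i, lexp (ℓ (j, s j)) := by
    rw [← Finset.add_sum_erase _ _ (Finset.mem_univ i)]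
  rw [h1, h2]
  abel

/-- Parent maps built from pointers of two surviving maps survive. [folklore] -/
theorem cst_ne_zero_of_pointers (ℓ : Fin N × Option (Fin N) → τ ⊕ ℝ≥0)
    {t t' s : Fin N → Option (Fin N)} (ht : cst ℓ t ≠ 0) (ht' : cst ℓ t' ≠ 0)
    (hs : ∀ j, s j = t j ∨ s j = t' j) : cst ℓ s ≠ 0 := by
  unfold cst at *
  rw [Finset.prod_ne_zero_iff] at *
  intro j hj
  rcases hs j with h | h <;> rw [h]; exacts [ht j hj, ht' j hj]



/-- **Split supports are not positive `ST`-projections.**  If the monomials of `P` split into a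
class `U` and its complement, both inhabited, such that no monomial outside `U` is one label
away from a monomial in `U` (`β + p = α + q`, `q ∈ {0} ∪ {e_j}`, `α ∈ U` forces `β ∈ U`), then
`P` is not a positive projection of any `ST_N`: the support of a positive `ST`-projection is
connected under one-label moves (`arborescence_chain_induction`, `vexp_update`). [folklore] -/
theorem not_posProj_stPoly_of_split {P : MvPolynomial τ ℝ≥0} (U : (τ →₀ ℕ) → Prop)
    (hU : ∃ α, coeff α P ≠ 0 ∧ U α) (hV : ∃ β, coeff β P ≠ 0 ∧ ¬ U β)
    (hsep : ∀ α β, coeff α P ≠ 0 → coeff β P ≠ 0 → U α → ∀ p q : τ →₀ ℕ,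
      (p = 0 ∨ ∃ j, p = Finsupp.single j 1) → (q = 0 ∨ ∃ j, q = Finsupp.single j 1) →
      β + p = α + q → U β) :
    ¬ ∃ (N : ℕ) (e : Fin N × Option (Fin N) → MvPolynomial τ ℝ≥0),
      (∀ v, (∃ j, e v = X j) ∨ ∃ r, e v = C r) ∧ aeval e (stPoly ℝ≥0 N) = P := by
  classical
  rintro ⟨N, e, he, heq⟩
  obtain ⟨ℓ, rfl⟩ : ∃ ℓ : Fin N × Option (Fin N) → τ ⊕ ℝ≥0,
      e = fun v => (Sum.elim X C (ℓ v) : MvPolynomial τ ℝ≥0) := by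
    refine ⟨fun v => if h : ∃ j, e v = X j then Sum.inl h.choose
      else Sum.inr ((he v).resolve_left h).choose, ?_⟩
    funext v
    by_cases h : ∃ j, e v = X j
    · simp only [dif_pos h, Sum.elim_inl]; exact h.choose_spec
    · simp only [dif_neg h, Sum.elim_inr]; exact ((he v).resolve_left h).choose_spec
  obtain ⟨α, hα, hUα⟩ := hU
  obtain ⟨β, hβ, hVβ⟩ := hV
  rw [← heq] at hα hβ hsep
  obtain ⟨t, ht, hvt, hct⟩ := exists_arborescence_of_coeff_ne_zero ℓ hα
  obtain ⟨t', ht', hvt', hct'⟩ := exists_arborescence_of_coeff_ne_zero ℓ hβ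
  have key := arborescence_chain_induction ht ht'
    (fun s => coeff (vexp ℓ s) (aeval (fun v => (Sum.elim X C (ℓ v) : MvPolynomial τ ℝ≥0))
      (stPoly ℝ≥0 N)) ≠ 0 ∧ U (vexp ℓ s)) ⟨hvt.symm ▸ hα, hvt.symm ▸ hUα⟩ ?_
  · exact hVβ (hvt' ▸ key.2)
  intro s i hs hsp hPs hs'
  have hsp' : ∀ j, Function.update s i (t' i) j = t j ∨ Function.update s i (t' i) j = t' j := by
    intro j
    by_cases hji : j = i
    · subst hji; right; exact Function.update_self _ _ _
    · rw [Function.update_of_ne hji]; exact hsp j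
  have hcs' : cst ℓ (Function.update s i (t' i)) ≠ 0 := cst_ne_zero_of_pointers ℓ hct hct' hsp'
  have hmem : coeff (vexp ℓ (Function.update s i (t' i)))
      (aeval (fun v => (Sum.elim X C (ℓ v) : MvPolynomial τ ℝ≥0)) (stPoly ℝ≥0 N)) ≠ 0 :=
    ne_of_gt (lt_of_lt_of_le (pos_iff_ne_zero.mpr hcs') (cst_le_coeff_aeval_stPoly ℓ hs'))
  have hupd := vexp_update ℓ s i (t' i)
  exact ⟨hmem, hsep _ _ hPs.1 hmem hPs.2 _ _ (lexp_cases _) (lexp_cases _) hupd⟩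

/-- **Isolated supports are not positive `ST`-projections.**  If `P` has two distinct monomials
and no two distinct monomials of `P` are one label apart (`β + p = α + q` with
`q ∈ {0} ∪ {e_j}` forces `α = β`), then `P` is not a positive projection of any `ST_N`.
[folklore] -/
theorem not_posProj_stPoly_of_isolated {P : MvPolynomial τ ℝ≥0}
    (h2 : ∃ α β, α ≠ β ∧ coeff α P ≠ 0 ∧ coeff β P ≠ 0)
    (hiso : ∀ α β, coeff α P ≠ 0 → coeff β P ≠ 0 → ∀ p q : τ →₀ ℕ,
      (q = 0 ∨ ∃ j, q = Finsupp.single j 1) → β + p = α + q → α = β) :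
    ¬ ∃ (N : ℕ) (e : Fin N × Option (Fin N) → MvPolynomial τ ℝ≥0),
      (∀ v, (∃ j, e v = X j) ∨ ∃ r, e v = C r) ∧ aeval e (stPoly ℝ≥0 N) = P := by
  obtain ⟨α, β, hαβ, hα, hβ⟩ := h2
  exact not_posProj_stPoly_of_split (fun γ => γ = α) ⟨α, hα, rfl⟩ ⟨β, hβ, fun h => hαβ h.symm⟩
    fun α' β' hα' hβ' hU p q _ hq h => (hU ▸ (hiso α' β' hα' hβ' p q hq h).symm)


end PosSubst

end

end Summit.ValiantsHypothesis.ValiantsHypothesis.Theorems.ZeroOneTransfer.Negative
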